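import Summits.Ventures.PercRepro.C041SkeletonPort

/-!
# THEOREM R, the reduction, first layer (side 2): the `Good_b` dictionary (p6, gen 23)

The mirror of `C041SkeletonPort.good_a_iff` for the other terminal: for a source of the singleton-attachment family,
`a` is red-reachable from `c` avoiding the blue cluster of `b` iff the port problem of `S` has `Good₂` at the pattern
of `S` (`good_b_iff`), with the mirrored auxiliaries `term_eq_two`, `mem_A₂_portOf_iff`, `mem_cluster_of_mem_A₂`,
`cluster_compl_b_subset_of_sing`.
-/

namespace PercRepro

namespace MultiGraph

open Finset PortProblem

variable {V E : Type*} {G : MultiGraph V E}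

section Port

variable [Fintype V] {a b c : V} (hc : ∀ e, ¬ G.Joins e c a ∧ ¬ G.Joins e c b) {S : Config E}

open Classical in
/-- A term of the port problem is determined by its name (side 2). -/
theorem term_eq_two {t : (G.portOf a b c hc S).Term} {u : V} (ht : t.1 = (u, true)) :
    ∃ (hu : u ∈ (G.portOf a b c hc S).M) (hk : (G.portOf a b c hc S).k₂ u = true),
      t = ⟨(u, true), hu, fun h => Bool.noConfusion h, fun _ => hk⟩ := by
  have h1 : t.1.1 = u := by rw [ht]
  have h2 : t.1.2 = true := by rw [ht]
  refine ⟨h1 ▸ t.2.1, h1 ▸ t.2.2.2 h2, Subtype.ext ht⟩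

open Classical in
/-- A port in state `2` has an edge to `b` and no red edge to `b`. -/
theorem mem_A₂_portOf_iff {u : V} : u ∈ (G.portOf a b c hc S).A₂ (G.patternOf a b c hc S) ↔
    u ∈ (G.portOf a b c hc S).M ∧ (∃ e, G.Joins e u b) ∧ ¬ ∃ e, G.Joins e u b ∧ S e = true := by
  constructor
  · rintro ⟨t, ht, hxt⟩
    obtain ⟨hu, hk, rfl⟩ := term_eq_two hc ht
    refine ⟨hu, decide_eq_true_iff.1 hk, ?_⟩
    rw [patternOf_two hc hu hk] at hxt
    exact decide_eq_false_iff_not.1 hxt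
  · rintro ⟨hu, ⟨e, he⟩, hnot⟩
    refine ⟨⟨(u, true), hu, fun h => Bool.noConfusion h, fun _ => decide_eq_true_iff.2 ⟨e, he⟩⟩, rfl, ?_⟩
    rw [patternOf_two hc hu (decide_eq_true_iff.2 ⟨e, he⟩)]
    exact decide_eq_false_iff_not.2 hnot

open Classical in
/-- A port deleted on side `2` lies in the blue cluster of `b`. -/
theorem mem_cluster_of_mem_A₂ {u : V} (hu : u ∈ (G.portOf a b c hc S).A₂ (G.patternOf a b c hc S)) :
    u ∈ G.cluster Sᶜ b := by
  rw [mem_A₂_portOf_iff] at hu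
  obtain ⟨_, ⟨e, he⟩, hnot⟩ := hu
  have hblue : S e = false := by
    cases h : S e
    · rfl
    · exact absurd ⟨e, he, h⟩ hnot
  rw [mem_cluster]
  exact Conn.of_openAdj ⟨e, by rw [compl_apply_not, hblue]; rfl, he.symm⟩

omit [Fintype V] in
/-- **The blue cluster of `b` under the singleton condition**: `b` and its blue neighbours. -/
theorem cluster_compl_b_subset_of_sing (hsing : G.Sing a b S) (hab : ¬ G.Conn Sᶜ a b) {v : V}
    (hv : v ∈ G.cluster Sᶜ b) : v = b ∨ ∃ e, G.Joins e v b ∧ S e = false := by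
  have hba : ¬ G.Conn Sᶜ b a := fun h => hab h.symm
  rw [mem_cluster] at hv
  have key : ∀ v, G.Conn Sᶜ b v → v = b ∨ ∃ e, G.Joins e v b ∧ S e = false := by
    intro v hv
    unfold Conn at hv
    induction hv with
    | refl => exact Or.inl rfl
    | @tail z v hz hzv ih =>
      obtain ⟨e', he', hj⟩ := hzv
      have hblue : S e' = false := by
        rw [compl_apply_not] at he'
        cases h : S e'
        · rfl
        · rw [h] at he'
          exact Bool.noConfusion he'
      have hjoin : G.Joins e' z v := hj
      by_cases hzb : z = b
      · subst hzb
        exact Or.inr ⟨e', hjoin.symm, hblue⟩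
      · rcases ih with hz' | ⟨e, hez, hSe⟩
        · exact absurd hz' hzb
        · have hnb : ¬ G.Bare a b e' := fun hb => by
            have := hsing z ⟨e, Or.inr hez, hSe⟩ e' hb (EdgeAt.of_joins_left hjoin)
            rw [this] at hblue
            exact Bool.noConfusion hblue
          by_cases hv : v = b
          · exact Or.inl hv
          · exfalso
            apply hnb
            have hza : G.Conn Sᶜ b z := hz
            have hva : G.Conn Sᶜ b v := Relation.ReflTransGen.tail hz ⟨e', he', hj⟩
            refine ⟨?_, ?_⟩
            · -- an edge at `a`: `z = a` or `v = a`, both blue-joined to `b`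
              rintro (h1 | h1) <;> rcases hjoin with ⟨h2, h3⟩ | ⟨h2, h3⟩
              · exact hba ((h2.symm.trans h1) ▸ hza)
              · exact hba ((h2.symm.trans h1) ▸ hva)
              · exact hba ((h3.symm.trans h1) ▸ hva)
              · exact hba ((h3.symm.trans h1) ▸ hza)
            · rintro (h1 | h1) <;> rcases hjoin with ⟨h2, h3⟩ | ⟨h2, h3⟩
              · exact hzb (h2.symm.trans h1)
              · exact hv (h2.symm.trans h1)
              · exact hv (h3.symm.trans h1)
              · exact hzb (h3.symm.trans h1)
  exact key v hv

open Classical in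
/-- **The `Good_b` dictionary**: `a` is red-reachable from `c` avoiding the blue cluster of `b` iff the port problem
has `Good₂`. -/
theorem good_b_iff (hsing : G.Sing a b S) (huniq : G.UniqTerm a b) (hca : ¬ G.Conn Sᶜ c a)
    (hcb : ¬ G.Conn Sᶜ c b) (hab : ¬ G.Conn Sᶜ a b) :
    G.WalkAvoiding S (G.cluster Sᶜ b) c a ↔
      (G.portOf a b c hc S).Good₂ (G.patternOf a b c hc S) := by
  have hcb' : c ≠ b := fun h => hcb (h ▸ Conn.refl G _ c)
  have hca' : c ≠ a := fun h => hca (h ▸ Conn.refl G _ c)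
  have hcW : c ∉ G.cluster Sᶜ b := fun h => hcb ((G.mem_cluster).1 h).symm
  have haW : a ∉ G.cluster Sᶜ b := fun h => hab ((G.mem_cluster).1 h).symm
  constructor
  · rintro ⟨_, hwalk⟩
    obtain ⟨w, ⟨hwa, _⟩, hcw⟩ := exists_last_step hwalk hca'
    have key : ∀ v, Relation.ReflTransGen
        (fun x y => (G.OpenAdj S x y ∧ y ∉ G.cluster Sᶜ b) ∧ y ≠ a) c v →
        (v ≠ a ∧ v ≠ b) ∧ Relation.ReflTransGen
          (fun x y => G.BareAdj a b S x y ∧ y ∉ (G.portOf a b c hc S).A₂ (G.patternOf a b c hc S)) c v := by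
      intro v hv
      induction hv with
      | refl => exact ⟨⟨hca', hcb'⟩, Relation.ReflTransGen.refl⟩
      | @tail x y _ hxy ih =>
        have hyb : y ≠ b := fun h => hxy.1.2 (by rw [h]; exact G.self_mem_cluster _ b)
        refine ⟨⟨hxy.2, hyb⟩, ih.2.tail ⟨bareAdj_of_openAdj hxy.1.1 ih.1 ⟨hxy.2, hyb⟩, ?_⟩⟩
        exact fun h => hxy.1.2 (mem_cluster_of_mem_A₂ hc h)
    obtain ⟨_, hbare⟩ := key w hcw
    obtain ⟨e, hSe, hje⟩ := hwa
    have hwK : w ∈ G.BareReach a b c S := reflTransGen_mono' (fun _ _ h => h.1) hbare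
    have hwM : w ∈ (G.portOf a b c hc S).M := (mem_portM hc).2 ⟨hwK, e, Or.inl hje⟩
    have hk : (G.portOf a b c hc S).k₁ w = true := decide_eq_true_iff.2 ⟨e, hje⟩
    refine ⟨⟨(w, false), hwM, fun _ => hk, fun h => Bool.noConfusion h⟩, rfl, ?_, ?_⟩
    · rw [patternOf_one hc hwM hk]
      exact decide_eq_true_iff.2 ⟨e, hje, hSe⟩
    · exact ⟨fun h => c_not_mem_portM hc (S := S) (Problem.A₂_subset _ h), hbare⟩
  · rintro ⟨t, ht2, hxt, hreach⟩
    have hu : t.1.1 ∈ (G.portOf a b c hc S).M := t.2.1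
    have hk : (G.portOf a b c hc S).k₁ t.1.1 = true := t.2.2.1 ht2
    have hteq : t = ⟨(t.1.1, false), hu, fun _ => hk, fun h => Bool.noConfusion h⟩ :=
      Subtype.ext (Prod.ext_iff.mpr ⟨rfl, ht2⟩)
    rw [hteq, patternOf_one hc hu hk] at hxt
    obtain ⟨e, hje, hSe⟩ := decide_eq_true_iff.1 hxt
    obtain ⟨_, hwalk⟩ := hreach
    refine ⟨hcW, ?_⟩
    have key : ∀ v, Relation.ReflTransGen
        (fun p q => G.BareAdj a b S p q ∧ q ∉ (G.portOf a b c hc S).A₂ (G.patternOf a b c hc S)) c v →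
        Relation.ReflTransGen (fun x y => G.OpenAdj S x y ∧ y ∉ G.cluster Sᶜ b) c v := by
      intro v hv
      induction hv with
      | refl => exact Relation.ReflTransGen.refl
      | @tail p q hcp hpq ih =>
        refine ih.tail ⟨hpq.1.openAdj, ?_⟩
        intro hqW
        obtain ⟨e', he', hS', hj'⟩ := hpq.1
        rcases cluster_compl_b_subset_of_sing hsing hab hqW with hqb | ⟨f, hf, hSf⟩
        · exact (ne_of_bare_joins he' hj').2.2 hqb
        · apply hpq.2
          rw [mem_A₂_portOf_iff]
          refine ⟨(mem_portM hc).2 ⟨reflTransGen_mono' (fun _ _ h => h.1) (hcp.tail hpq), f, Or.inr hf⟩,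
            ⟨f, hf⟩, ?_⟩
          rintro ⟨f', hf', hSf'⟩
          rw [huniq.2 q f' f hf' hf] at hSf'
          rw [hSf] at hSf'
          exact Bool.noConfusion hSf'
    exact (key _ hwalk).tail ⟨⟨e, hSe, hje⟩, haW⟩

end Port

end MultiGraph

end PercRepro
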